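import Summits.CriticalPhenomena.PercolationContinuityZ3.Theorems.PercNearOneGluingNoHeavyLowerTailAntipodalR1OneSumTerminal
import Summits.CriticalPhenomena.PercolationContinuityZ3.Theorems.PercNearOneGluingNoHeavyLowerTailAntipodalR1NestedGraded
import HarnessLib

/-!
# ANTI₁ across a cut vertex: the degenerate placements, and the `b ↔ c` symmetry

Support file for `stmt-CriticalPhenomena-4575` (memo `prim-gen-kcluster/KCLUSTER-gen73.md` §1.8 (D),
§1.6; conjecture ANTI₁ of `KCLUSTER-gen52.md` §3).  No definitions, no named facts, no sorries.
Vocabulary of `AntipodalR1` (gen 62) and the cut-vertex lemmas of `…AntipodalR1OneSumApex`,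
`…AntipodalR1OneSumTerminal` (gen 78).

* `card_lSet_le_card_rSet_comm` — ANTI₁ is symmetric in the two terminals (from `lSet_comm`,
  `card_rSet_comm` of `…AntipodalR1NestedGraded`);
* `lSet_self` — `L(a, b, b) = ∅`;
* **`card_lSet_eq_card_rSet_of_apexCut`** — if the APEX is a cut vertex separating the terminals
  (`G = P ∪_a Q`, `b` on the `P` side, `c` interior to `Q`), then `#L = #R(b, c)` EXACTLY:
  `L = T_P(b) × T_Q(c)` and `R = T_P(b) × σT_Q(c)` with `T(v) = {v ∈ O_a ∖ K_a}` (memo §1.6);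
* `card_lSet_le_card_rSet_of_terminalCut` — if a TERMINAL is a cut vertex separating the apex from
  the other terminal, `L = ∅` and ANTI₁ holds trivially (memo §1.8 (D)).
Together with `…TwoCutCutVertex` (A), `…OneSumApex` (B), `…OneSumTerminal` (C): for every 1-sum
`G = G₁ ∪_u G₂` and every placement of `a, b, c`, ANTI₁ for `G` follows from ANTI₁ for ONE smaller
instance (or from nothing) — a counterexample to ANTI₁ with the fewest edges is 2-connected.
[this work]
-/

namespace Summit.CriticalPhenomena.PercolationContinuityZ3.Theorems

namespace AntipodalR1

open Finset Relation

variable {V ι ιP ιQ : Type*}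

section Symmetry

variable [Fintype ι] [DecidableEq ι]

/-- ANTI₁ is symmetric in the two terminals (`AntipodalR1.lSet_comm`, `AntipodalR1.card_rSet_comm`).
[this work] -/
theorem card_lSet_le_card_rSet_comm (ends : ι → Sym2 V) (a b c : V)
    (h : (lSet ends a b c).card ≤ (rSet ends a b c).card) :
    (lSet ends a c b).card ≤ (rSet ends a c b).card := by
  rw [← lSet_comm, ← card_rSet_comm]; exact h

/-- `L(a, b, b) = ∅`: a terminal is not separated from itself. [this work] -/
theorem lSet_self (ends : ι → Sym2 V) (a b : V) : lSet ends a b b = ∅ := by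
  classical
  refine filter_eq_empty_iff.2 fun x _ h => ?_
  exact h.2.2.2.2 (mem_region.2 ReflTransGen.refl)

end Symmetry

section ApexCut

variable {endsP : ιP → Sym2 V} {endsQ : ιQ → Sym2 V} {a b c : V}
variable [Fintype ιP] [DecidableEq ιP] [Fintype ιQ] [DecidableEq ιQ]

/-- **`L = T_P(b) × T_Q(c)` and `R ∘ σ_Q = T_P(b) × T_Q(c)` fibrewise.**  With the apex a cut vertex
(`G = P ∪_a Q`, `b` on the `P` side, `c` interior to `Q`): `ω_P ⊕ ω_Q ∈ L(G)` iff
`ω_P ⊕ σω_Q ∈ R(G)`. [this work] -/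
theorem mem_lSet_iff_mem_rSet_flip_of_apexCut
    (hsep : ∀ w i, w ∈ endsP i → ∀ j, w ∈ endsQ j → w = a) (hb : ∀ j, b ∈ endsQ j → b = a)
    (hcQ : ∃ j, c ∈ endsQ j) (hca : c ≠ a) (ωP : ιP → Bool) (ωQ : ιQ → Bool) :
    Sum.elim ωP ωQ ∈ lSet (Sum.elim endsP endsQ) a b c ↔
      Sum.elim ωP (fun j => !ωQ j) ∈ rSet (Sum.elim endsP endsQ) a b c := by
  classical
  have ha : ∀ j, a ∈ endsQ j → a = a := fun _ _ => rfl
  have hbG : ∀ (ω : ιP ⊕ ιQ → Bool) col, b ∈ clus (Sum.elim endsP endsQ) ω col a ↔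
      b ∈ clus endsP (fun i => ω (Sum.inl i)) col a :=
    fun ω col => mem_clus_iff_of_cutVertex hsep ha hb
  have hcG : ∀ (ω : ιP ⊕ ιQ → Bool) col, c ∈ clus (Sum.elim endsP endsQ) ω col a ↔
      c ∈ clus endsQ (fun j => ω (Sum.inr j)) col a :=
    fun ω col => (mem_clus_iff_of_interior hsep ha hcQ hca).trans
      ⟨fun h => h.2, fun h => ⟨ReflTransGen.refl, h⟩⟩
  have hflip : ∀ col, c ∈ clus endsQ (fun j => !ωQ j) col a ↔ c ∈ clus endsQ ωQ (!col) a :=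
    fun col => mem_clus_flip endsQ ωQ col a c
  simp only [lSet, rSet, mem_filter, mem_univ, true_and]
  rw [hbG, hbG, hcG, hcG, hbG, hbG, hcG, hcG]
  constructor
  · rintro ⟨hOb, hKb, hOc, hKc, -⟩
    exact ⟨hOb, hKb, (hflip false).2 hOc, fun h => hKc ((hflip true).1 h)⟩
  · rintro ⟨hOb, hKb, hKc, hOc⟩
    refine ⟨hOb, hKb, (hflip false).1 hKc, fun h => hOc ((hflip true).2 h), fun hreg => ?_⟩
    -- every `b–c` path passes through the apex: `a` would avoid `K_a`
    have haP := (region_near_of_region (ω := Sum.elim ωP ωQ) hsep ha hb hreg).2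
      (fun h' => hcQ.elim fun j hj => hca (h' j hj))
    exact not_mem_clus_of_region hKb (mem_region.1 haP) ReflTransGen.refl

/-- **ANTI₁ with equality when the apex separates the terminals** (memo `KCLUSTER-gen73` §1.6, §1.8
(D)).  Let `G = P ∪ Q` be glued at the apex `a` alone (every vertex met by edges of both sides is `a`),
with `b` met by edges of `Q` only if `b = a` and `c` interior to `Q` (met by an edge of `Q`, `c ≠ a`).
Then `#L(G; a, b, c) = #R(G; a; b, c)`. [this work] -/
theorem card_lSet_eq_card_rSet_of_apexCut (endsP : ιP → Sym2 V) (endsQ : ιQ → Sym2 V)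
    (a b c : V)
    (hsep : ∀ w i, w ∈ endsP i → ∀ j, w ∈ endsQ j → w = a) (hb : ∀ j, b ∈ endsQ j → b = a)
    (hcQ : ∃ j, c ∈ endsQ j) (hca : c ≠ a) :
    (lSet (Sum.elim endsP endsQ) a b c).card = (rSet (Sum.elim endsP endsQ) a b c).card := by
  classical
  calc (lSet (Sum.elim endsP endsQ) a b c).card
      = ∑ ωQ : ιQ → Bool, (univ.filter fun ωP : ιP → Bool =>
          Sum.elim ωP ωQ ∈ lSet (Sum.elim endsP endsQ) a b c).card := card_eq_sum_card_fibre _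
    _ = ∑ ωQ : ιQ → Bool, (univ.filter fun ωP : ιP → Bool =>
          Sum.elim ωP (fun j => !ωQ j) ∈ rSet (Sum.elim endsP endsQ) a b c).card := by
        refine sum_congr rfl fun ωQ _ => congrArg Finset.card (filter_congr fun ωP _ => ?_)
        exact mem_lSet_iff_mem_rSet_flip_of_apexCut hsep hb hcQ hca ωP ωQ
    _ = ∑ ωQ : ιQ → Bool, (univ.filter fun ωP : ιP → Bool =>
          Sum.elim ωP ωQ ∈ rSet (Sum.elim endsP endsQ) a b c).card :=
        sum_flip_eq (fun ωQ => (univ.filter fun ωP : ιP → Bool =>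
          Sum.elim ωP ωQ ∈ rSet (Sum.elim endsP endsQ) a b c).card)
    _ = (rSet (Sum.elim endsP endsQ) a b c).card := (card_eq_sum_card_fibre _).symm

/-- ANTI₁ when the apex separates the terminals (inequality form of
`card_lSet_eq_card_rSet_of_apexCut`). [this work] -/
theorem card_lSet_le_card_rSet_of_apexCut (endsP : ιP → Sym2 V) (endsQ : ιQ → Sym2 V)
    (a b c : V)
    (hsep : ∀ w i, w ∈ endsP i → ∀ j, w ∈ endsQ j → w = a) (hb : ∀ j, b ∈ endsQ j → b = a)
    (hcQ : ∃ j, c ∈ endsQ j) (hca : c ≠ a) :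
    (lSet (Sum.elim endsP endsQ) a b c).card ≤ (rSet (Sum.elim endsP endsQ) a b c).card :=
  (card_lSet_eq_card_rSet_of_apexCut endsP endsQ a b c hsep hb hcQ hca).le

end ApexCut

section TerminalCut

variable {ιN ιF : Type*} [Fintype ιN] [DecidableEq ιN] [Fintype ιF] [DecidableEq ιF]

/-- **ANTI₁ when a terminal separates the apex from the other terminal** (memo `KCLUSTER-gen73` §1.8
(D)): `G = N ∪ F` glued at the terminal `b` alone, the apex `a` met by edges of `F` only if `a = b`,
and `c` interior to `F`.  Then ANTI₁ holds (indeed `L = ∅`). [this work] -/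
theorem card_lSet_le_card_rSet_of_terminalCut (endsN : ιN → Sym2 V) (endsF : ιF → Sym2 V)
    (a b c : V)
    (hsep : ∀ w i, w ∈ endsN i → ∀ j, w ∈ endsF j → w = b) (ha : ∀ j, a ∈ endsF j → a = b)
    (hcF : ∃ j, c ∈ endsF j) (hcb : c ≠ b) :
    (lSet (Sum.elim endsN endsF) a b c).card ≤ (rSet (Sum.elim endsN endsF) a b c).card :=
  card_lSet_le_card_rSet_of_terminalBlock endsN endsF b a b c hsep ha (fun _ _ => rfl) hcF hcb
    (by rw [lSet_self]; exact Nat.zero_le _)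

end TerminalCut

end AntipodalR1

end Summit.CriticalPhenomena.PercolationContinuityZ3.Theorems
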